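import Summits.QuantumFields.YangMills.Theorems.BalabanUVNodesN09AtSmallFieldBookkeeping

/-!
# BalabanUVNodes ∕ N09 at the STAGE-13 v1.7 `SepCoPH` record — the `∀ P` shape of the TWO-RADII DOOR OF RECORD (small-field domains as bookkeeping sets;
# the one-orbit and solvability clauses DERIVED): dag-n24-c's `h09T` supplier TYPE ([Balaban1987RG1] Thm 3 p. 264; [Balaban1985Variational] Thm 1 p. 279)

TRACK A (YM-PLAN §2b, node N09 of 28 = [B12]), WIDTH SEAT `pub-ymgap-dag-n09-w3` (g2; D-0149), FILE 5 — a ten-line `∀ P` packaging of FILE 2's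
★★★ `…N09AtSmallFieldBookkeeping.thm3Member_stage13SepCoPH_atDomAlt_of_thm1_of_reg8` (p598357), filed separately because FILE 2 sits at the 400-line cap.  Key of record:
K1⁷ `StabilityBAtRecordR13SepCoPH` = stmt-QuantumFields-20542 (`--supports`, count-neutral helper).  THEOREMS ONLY, def-free, sorry-free, standard axioms.

WHY.  dag-n24-c g9's 31H (`…N24ChildrenSplitN09Suppliers`, INTENT-40) keys N09's Theorem-3 member on the TYPE `∀ P, (leavesP w P).smallCouplings → (leavesP w P).smallFieldInductive`
at a world bound to the record and cites this seat's `∀ P` door `thm3Member_forall_stage13SepCoPH_atDomAlt_of_orbitRel` (one-orbit clause `horb` and solvability `hsolν` DISPLAYED).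
At the record's two radii both are dag-n09-w1 g2's THEOREMS from [B11] ×3 + the located (8)-clause `hreg8` + `0 ≤ εreg ≤ εbg` (FILE 2 §3); this file is the same door in the
`∀ P` shape, so a consumer's N09 list reads: `hε`, `hreg8`, `hle`, `hεreg`, (181)ˢᵒˡ `hcov`, the support clause at the domains `hχdom`, (I19) `hint`, the analytic inclusion
`hreg`, [B11] ×3 `h11 ∕ hres ∕ huniq` — NO set family, NO nesting, NO orbit clause, NO solvability clause, NO hereditary selection, NO axial convention.

HONEST FRAMING: count-neutral composition BY NAME; NOTHING of Bałaban's asserted (every binder DISPLAYED and located); N09 NOT discharged; K0⁷ ∕ K1⁷ NOT closed; counts unmoved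
(typed 28∕28 · discharged 5∕27); one finite four-torus programme at fixed `ε = L^{−K}` per run — R4 closes the conditional rung `BalabanLadder.UV` only; NOT ℝ⁴, NOT infinite
volume, NOT OS, NOT a mass gap; the Yang–Mills mass gap (Clay) is NOT proved by any of this.
-/

noncomputable section

namespace Summit.QuantumFields.YangMills.BalabanUVNodes.N09TwoRadiiDoorForall

open MeasureTheory Set
open Literature.MathematicalPhysics.QuantumFieldTheory.Balaban1983to89
open Literature.MathematicalPhysics.QuantumFieldTheory.Balaban1983to89.T4Continuum (T4Family)
open Literature.MathematicalPhysics.QuantumFieldTheory.Balaban1983to89.DagBinding (WorldP leavesP)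
open Literature.MathematicalPhysics.QuantumFieldTheory.Balaban1983to89.Node00
open Literature.MathematicalPhysics.QuantumFieldTheory.Balaban1983to89.B12RTGaugeInvariance254 (liftTransf)
open Literature.MathematicalPhysics.QuantumFieldTheory.Balaban1983to89.GaugeField (gaugeAct)
open Literature.MathematicalPhysics.QuantumFieldTheory.Balaban1983to89.B12NodeKnitRecord8 (b12_main_of_leaf_of_thm3Member)
open N09AtSmallFieldBookkeeping (thm3Member_stage13SepCoPH_atDomAlt_of_thm1_of_reg8)

variable {F : T4Family} {N : ℕ} [NeZero N]

/-- ★★★ **THE `∀ P` FORM OF THE TWO-RADII DOOR OF RECORD** (= N24's displayed binder `h09T` at a world bound to the Stage-13 v1.7 construction, dag-n24-c's supplier TYPE):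
FILE 2's `thm3Member_stage13SepCoPH_atDomAlt_of_thm1_of_reg8` run by run.  N09-side inputs: `hε`, `hreg8`, `hle`, `hεreg`, (181)ˢᵒˡ `hcov`, `hχdom`, (I19) `hint`, `hreg`,
[B11] ×3 — NO orbit clause, NO solvability clause, NO set family, NO nesting.  CONDITIONAL; nothing of Bałaban asserted; N09 NOT discharged; K1⁷ NOT closed.
[cite: Balaban1987RG1, Thm 3 p.264, p.259, (1.1)–(1.3) p.260, (2.1)–(2.3) p.265, (2.9)–(2.10) pp.266–267; Balaban1985Variational, Thm 1 (6), (8)–(10) p.279 and (181) p.307] -/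
theorem thm3Member_forall_stage13SepCoPH_atDomAlt_of_thm1_of_reg8 (θ : Stage13HParams F N) (h : θ.Provisos₁₃SepCoPH F N) {w : WorldP}
    (hC : w.C = (datumOfRecord₁₃SepCoPH F N θ h).C) (hε : 0 < θ.ε₂₉)
    (hreg8 : ∀ (P : B12.RunParams) (k : ℕ), k ≤ P.K → ∀ V ∈ domAltOfRecord F N θ.ν P.K k, Uk F N P.K k θ.εbg V ∈ bgReg F N P.K k θ.toStage13Params.ν.εreg)
    (hle : θ.toStage13Params.ν.εreg ≤ θ.εbg) (hεreg : 0 ≤ θ.toStage13Params.ν.εreg)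
    (hcov : ∀ (P : B12.RunParams), ∀ j < P.K, ∀ (v : GaugeTransf (F.P P.K) (j + 1) (SU N)) (W : GaugeField (F.P P.K) (j + 1) (SU N)),
      UkExists F N P.K (j + 1) θ.toStage13Params.ν.εreg W →
        critCfgOfRecord F N θ.toStage13Params.ν P.K j (gaugeAct v W) = gaugeAct (liftTransf v) (critCfgOfRecord F N θ.toStage13Params.ν P.K j W))
    (hχdom : ∀ (P : B12.RunParams), ∀ j < P.K, ∀ U : GaugeField (F.P P.K) j (SU N), (avOfRecord F N P.K j).avg U ∈ domAltOfRecord F N θ.ν P.K (j + 1) →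
      U ∉ domAltOfRecord F N θ.ν P.K j → chiβOfRecord₁₃ F N θ.toStage13Params P.K (gOfRecord₁₃ F N θ.toStage13Params P) j U = 0)
    (hint : ∀ (P : B12.RunParams), ∀ j < P.K, Integrable (betaInputOfRecord F N (TβOfRecord₁₃ F N) (chiβOfRecord₁₃ F N θ.toStage13Params) P.K
      (gOfRecord₁₃ F N θ.toStage13Params P) j) (fieldMeasure (F.P P.K) j (SU N)))
    (hreg : ∀ (P : B12.RunParams), ∀ j < P.K, domAltOfRecord F N θ.ν P.K (j + 1) ⊆ regSetOfRecord F N P.K j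
      (betaInputOfRecord F N (TβOfRecord₁₃ F N) (chiβOfRecord₁₃ F N θ.toStage13Params) P.K (gOfRecord₁₃ F N θ.toStage13Params P) j))
    (h11 : ∀ (P : B12.RunParams) (k : ℕ), k ≤ P.K → ∀ V ∈ domAltOfRecord F N θ.ν P.K k, UkExists F N P.K k θ.εbg V ∧ UniqueUkOrbit F N P.K k θ.εbg V)
    (hres : ∀ (P : B12.RunParams) (k : ℕ), k ≤ P.K → HRestrict F N θ.εbg P.K k (domAltOfRecord F N θ.ν P.K k))
    (huniq : ∀ (P : B12.RunParams) (k : ℕ), k ≤ P.K → ∀ V ∈ domAltOfRecord F N θ.ν P.K k, ∀ j < k,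
      UniqueUkOrbit F N P.K (j + 1) θ.εbg (Averaging.iter (avOfRecord F N P.K) (j + 1) (Uk F N P.K k θ.εbg V))) :
    ∀ P : B12.RunParams, (leavesP w P).smallCouplings → (leavesP w P).smallFieldInductive :=
  fun P => thm3Member_stage13SepCoPH_atDomAlt_of_thm1_of_reg8 θ h hC P hε (hreg8 P) hle hεreg (hcov P) (hχdom P) (hint P) (hreg P) (h11 P) (hres P) (huniq P)

/-- **… and N09 AT EVERY RUN `(w, P)` WITH ITS OWN LEAF**: given the run-indexed leaf `h12 : ∀ P, (leavesP w P).b12` ([I] Lemma 4), `∀ P, Dag.B12_main (leavesP w P)`.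
CONDITIONAL; N09 NOT discharged. [cite: Balaban1987RG1, Lemma 4 (3.53) p.280, Thm 3 p.264 and (1.1)–(1.3) p.260; Balaban1985Variational, Thm 1 p.279 and (181) p.307] -/
theorem b12_main_forall_stage13SepCoPH_atDomAlt_of_thm1_of_reg8 (θ : Stage13HParams F N) (h : θ.Provisos₁₃SepCoPH F N) {w : WorldP}
    (hC : w.C = (datumOfRecord₁₃SepCoPH F N θ h).C) (h12 : ∀ P : B12.RunParams, (leavesP w P).b12) (hε : 0 < θ.ε₂₉)
    (hreg8 : ∀ (P : B12.RunParams) (k : ℕ), k ≤ P.K → ∀ V ∈ domAltOfRecord F N θ.ν P.K k, Uk F N P.K k θ.εbg V ∈ bgReg F N P.K k θ.toStage13Params.ν.εreg)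
    (hle : θ.toStage13Params.ν.εreg ≤ θ.εbg) (hεreg : 0 ≤ θ.toStage13Params.ν.εreg)
    (hcov : ∀ (P : B12.RunParams), ∀ j < P.K, ∀ (v : GaugeTransf (F.P P.K) (j + 1) (SU N)) (W : GaugeField (F.P P.K) (j + 1) (SU N)),
      UkExists F N P.K (j + 1) θ.toStage13Params.ν.εreg W →
        critCfgOfRecord F N θ.toStage13Params.ν P.K j (gaugeAct v W) = gaugeAct (liftTransf v) (critCfgOfRecord F N θ.toStage13Params.ν P.K j W))
    (hχdom : ∀ (P : B12.RunParams), ∀ j < P.K, ∀ U : GaugeField (F.P P.K) j (SU N), (avOfRecord F N P.K j).avg U ∈ domAltOfRecord F N θ.ν P.K (j + 1) →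
      U ∉ domAltOfRecord F N θ.ν P.K j → chiβOfRecord₁₃ F N θ.toStage13Params P.K (gOfRecord₁₃ F N θ.toStage13Params P) j U = 0)
    (hint : ∀ (P : B12.RunParams), ∀ j < P.K, Integrable (betaInputOfRecord F N (TβOfRecord₁₃ F N) (chiβOfRecord₁₃ F N θ.toStage13Params) P.K
      (gOfRecord₁₃ F N θ.toStage13Params P) j) (fieldMeasure (F.P P.K) j (SU N)))
    (hreg : ∀ (P : B12.RunParams), ∀ j < P.K, domAltOfRecord F N θ.ν P.K (j + 1) ⊆ regSetOfRecord F N P.K j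
      (betaInputOfRecord F N (TβOfRecord₁₃ F N) (chiβOfRecord₁₃ F N θ.toStage13Params) P.K (gOfRecord₁₃ F N θ.toStage13Params P) j))
    (h11 : ∀ (P : B12.RunParams) (k : ℕ), k ≤ P.K → ∀ V ∈ domAltOfRecord F N θ.ν P.K k, UkExists F N P.K k θ.εbg V ∧ UniqueUkOrbit F N P.K k θ.εbg V)
    (hres : ∀ (P : B12.RunParams) (k : ℕ), k ≤ P.K → HRestrict F N θ.εbg P.K k (domAltOfRecord F N θ.ν P.K k))
    (huniq : ∀ (P : B12.RunParams) (k : ℕ), k ≤ P.K → ∀ V ∈ domAltOfRecord F N θ.ν P.K k, ∀ j < k,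
      UniqueUkOrbit F N P.K (j + 1) θ.εbg (Averaging.iter (avOfRecord F N P.K) (j + 1) (Uk F N P.K k θ.εbg V))) :
    ∀ P : B12.RunParams, Dag.B12_main (leavesP w P) :=
  fun P => b12_main_of_leaf_of_thm3Member (h12 P)
    (thm3Member_forall_stage13SepCoPH_atDomAlt_of_thm1_of_reg8 θ h hC hε hreg8 hle hεreg hcov hχdom hint hreg h11 hres huniq P)

end Summit.QuantumFields.YangMills.BalabanUVNodes.N09TwoRadiiDoorForall

end
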